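import Summits.QuantumFields.QCD.Theorems.PauliWegnerSeaChiralGluonicCompletionDefs

/-!
# Crux `ChiralGluonicCompletion` (stmt-QuantumFields-17498), line `Sketch` — the SHAPE of the chiral pin does not entail
# the hereditary pin E* (a kernel-checked countermodel; lead cycle 5, 2026-08-17)

The registered chirality stub of the line is E* = `stub_hereditaryPin`: from the crux's hypothesis `Hyp N_f reg`, SOME
subsequence `reg.restrict φ` is chiral at zero along EVERY further subsequence.  Cycle 3 certified that along subsequences
E* ⟺ the EVENTUAL (`∀ᶠ k`) pin ⟺ scale-coherence of the gap violations (`hereditaryPin_iff_eventualPin_along_subsequences`,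
`PauliWegnerSeaChiralGluonicCompletionStubHereditaryPin.lean`) and returned the verdict "not derivable from `Hyp`".  This
file makes the negative half of that verdict precise at the level of pure logic, which is all a selection argument can use.

Abstract the hypothesis to what it says about gap violations: a predicate `V ε m k` — "at cutoff `k` the positive tuple `m`
(with its channel; the level `C` folded in) violates the `ε`-gap bound" — ANTITONE in the rate (a violation at rate `ε` is
one at every rate `ε' ≥ ε`, as for `¬ HasLatticeMassGap`), subject only to the SHAPE of `QCDRegularisation.IsChiralAtZero`:
`∀ ε > 0, ∃ m > 0, ∃ᶠ k, V ε m k`.  The per-mass clauses (i)–(iv) and PQFD of `Hyp` constrain each tuple separately, with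
`m`-dependent constants, and say nothing about `V` across tuples or cutoffs.  E* asks for
`∃ φ, ∀ ψ, ∀ ε > 0, ∃ m > 0, ∃ᶠ k, V ε m (φ (ψ k))` — with the freedom to RE-CHOOSE the tuple per rate and per subsequence,
which is what makes the question more than "`∃ᶠ` is not subsequence-stable".

`pinShape_not_entails_hereditaryPin`: there is an antitone `V` with the pin's shape that is hereditarily pinned along NO
subsequence.  Model: group the cutoffs into infinitely many infinite blocks (`(Nat.unpair k).1 = i`); at a cutoff of block
`i` exactly the tuple `1/(i+1)` is light, with "pion mass" `1/(i+1)`.  Every rate is violated infinitely often (inside one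
block, at that block's tuple), but a subsequence either meets some block `i₀` infinitely often — along that
sub-subsequence nothing is lighter than `1/(i₀+1)` — or leaves every block eventually — then every fixed tuple is
eventually heavy at rate `1`.  `eventualShape_hereditary` records the contrast: the EVENTUAL shape is hereditary by logic
alone (the abstract form of the landed `hereditaryPin_of_eventual`).

Reading for the crux (no statement about lattice QCD is made here): any proof of E* from `Hyp` must use an input absent
from the shape of `Hyp` — analytic structure tying different masses and cutoffs together (continuity of the lattice
correlators in the bare mass uniformly in the cutoff and a compact parametrisation of the offset of `m_crit`, i.e.
`DiagonalSpine.MassEquicontinuity` / `ChiralTuning`-type content for the GIVEN regularisation) or the eventual form of the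
pin itself; selection / diagonal arguments over the typed `∃ᶠ` pin cannot supply it.
-/

namespace Summit.QuantumFields.QCD.Theorems.StronglyChiralSubsequence

open Filter

/-- **The shape of the chiral pin does not entail the hereditary pin E*.**  There is a violation predicate
`V : ℝ → ℝ → ℕ → Prop` (rate, mass, cutoff), antitone in the rate, with the pin's shape
`∀ ε > 0, ∃ m > 0, ∃ᶠ k, V ε m k`, such that NO subsequence `φ` is hereditarily pinned: for every strictly increasing `φ`
some strictly increasing `ψ` and some rate `ε > 0` have every tuple failing `∃ᶠ k, V ε m (φ (ψ k))`.  Witness: with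
`i(k) := (Nat.unpair k).1`, `V ε m k :↔ ∃ i, m = 1/(i+1) ∧ i(k) = i ∧ 1/(i+1) < ε`. -/
theorem pinShape_not_entails_hereditaryPin :
    ∃ V : ℝ → ℝ → ℕ → Prop,
      (∀ ε ε' m k, V ε m k → ε ≤ ε' → V ε' m k) ∧
      (∀ ε > (0 : ℝ), ∃ m : ℝ, 0 < m ∧ ∃ᶠ k in atTop, V ε m k) ∧
      ¬ ∃ φ : ℕ → ℕ, StrictMono φ ∧ ∀ ψ : ℕ → ℕ, StrictMono ψ →
          ∀ ε > (0 : ℝ), ∃ m : ℝ, 0 < m ∧ ∃ᶠ k in atTop, V ε m (φ (ψ k)) := by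
  refine ⟨fun ε m k => ∃ i : ℕ, m = 1 / ((i : ℝ) + 1) ∧ (Nat.unpair k).1 = i ∧ 1 / ((i : ℝ) + 1) < ε,
    fun ε ε' m k ⟨i, hm, hk, hi⟩ hle => ⟨i, hm, hk, hi.trans_le hle⟩, fun ε hε => ?_, ?_⟩
  · -- the pin's shape: rate `ε` is violated at the tuple `1/(i+1) < ε`, at every cutoff of block `i`
    obtain ⟨i, hi⟩ := exists_nat_one_div_lt hε
    refine ⟨1 / ((i : ℝ) + 1), Nat.one_div_pos_of_nat, ?_⟩
    refine (frequently_atTop.2 fun a => ⟨Nat.pair i a, Nat.right_le_pair i a, ?_⟩).mono fun k hk => ⟨i, rfl, hk, hi⟩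
    simp [Nat.unpair_pair]
  · -- no subsequence is hereditarily pinned
    rintro ⟨φ, -, hher⟩
    -- a further subsequence `ψ` and a rate `ε > 0` at which every tuple is eventually NOT violated along `φ ∘ ψ`
    obtain ⟨ψ, hψ, ε, hε, hnot⟩ : ∃ ψ : ℕ → ℕ, StrictMono ψ ∧ ∃ ε > (0 : ℝ), ∀ m : ℝ, ∀ᶠ k in atTop,
        ¬ ∃ i : ℕ, m = 1 / ((i : ℝ) + 1) ∧ (Nat.unpair (φ (ψ k))).1 = i ∧ 1 / ((i : ℝ) + 1) < ε := by
      by_cases h : ∃ i₀ : ℕ, ∃ᶠ k in atTop, (Nat.unpair (φ k)).1 = i₀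
      · -- some block `i₀` is met infinitely often: extract it; nothing there is lighter than `1/(i₀+1)`
        obtain ⟨i₀, hi₀⟩ := h
        obtain ⟨ψ, hψ, hψi⟩ := extraction_of_frequently_atTop hi₀
        refine ⟨ψ, hψ, 1 / ((i₀ : ℝ) + 1), Nat.one_div_pos_of_nat, fun m => Eventually.of_forall fun k => ?_⟩
        rintro ⟨i, -, hk, hi⟩
        rw [hψi k] at hk
        subst hk
        exact lt_irrefl _ hi
      · -- every block is left eventually: every fixed tuple is eventually heavy at rate `1`
        simp only [not_exists, not_frequently] at h
        refine ⟨id, strictMono_id, 1, one_pos, fun m => ?_⟩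
        by_cases hm : ∃ i : ℕ, m = 1 / ((i : ℝ) + 1)
        · obtain ⟨i, rfl⟩ := hm
          refine (h i).mono fun k hk => ?_
          rintro ⟨j, hj, hk', -⟩
          rw [one_div, one_div, inv_inj] at hj
          have hij : i = j := by exact_mod_cast add_right_cancel hj
          exact hk (hk'.trans hij.symm)
        · exact Eventually.of_forall fun k ⟨i, hi, _, _⟩ => hm ⟨i, hi⟩
    obtain ⟨m, -, hfreq⟩ := hher ψ hψ ε hε
    obtain ⟨k, hk₁, hk₂⟩ := ((hnot m).and_frequently hfreq).exists
    exact hk₁ hk₂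

/-- **By contrast the EVENTUAL shape of the pin is hereditary by logic alone** (abstract form of the landed
`hereditaryPin_of_eventual`): if every rate is violated at some positive tuple for ALL LARGE cutoffs, then along every
subsequence of every subsequence every rate is violated at some positive tuple frequently (indeed eventually). -/
theorem eventualShape_hereditary (V : ℝ → ℝ → ℕ → Prop)
    (h : ∀ ε > (0 : ℝ), ∃ m : ℝ, 0 < m ∧ ∀ᶠ k in atTop, V ε m k) (φ : ℕ → ℕ) (hφ : StrictMono φ)
    (ψ : ℕ → ℕ) (hψ : StrictMono ψ) :
    ∀ ε > (0 : ℝ), ∃ m : ℝ, 0 < m ∧ ∃ᶠ k in atTop, V ε m (φ (ψ k)) := fun ε hε => by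
  obtain ⟨m, hm, hev⟩ := h ε hε
  exact ⟨m, hm, ((hφ.comp hψ).tendsto_atTop.eventually hev).frequently⟩

end Summit.QuantumFields.QCD.Theorems.StronglyChiralSubsequence
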